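import Mathlib
import HarnessLib

/-!
# Newton's method applied to a convex majorant function: the scalar sequence `t_{n+1} = tₙ − f(tₙ)/f'(tₙ)` (Ezquerro–Hernández 2017, Theorems 1.21 and 2.7, proof of Theorem 1.27)

Topic `Literature/Analysis/Calculus`, companion of `KantorovichMajorantPrinciple.lean` (majorizing
sequences, Theorem 1.20) and of the Newton–Kantorovich files.  In Kantorovich's technique the Newton
iterates `x_{n+1} = x_n − F'(xₙ)⁻¹F(xₙ)` in a Banach space are majorized by the SCALAR Newton sequence

  `t_{n+1} = N_f(tₙ) = tₙ − f(tₙ)/f'(tₙ)`,  `t₀` given,                                   (1.34)/(2.13)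

of a real "majorant function" `f` (J. A. Ezquerro Fernández, M. Á. Hernández Verón, *Newton's Method:
an Updated Approach of Kantorovich's Theory*, Birkhäuser 2017 [EzquerrofernandezHernandezveron2017],
Definition 1.26).  Everything then rests on the elementary fact that for a function `f` which is
positive, decreasing and convex to the left of its smallest zero `t* ≥ t₀`, the sequence (1.34) is
nondecreasing and converges to `t*`:

* **Theorem 1.21** (Kantorovich's polynomial `p(s) = (M/2)s² − s/β + η/β`): `{sₙ}` is nondecreasing and
  converges to the smallest positive zero `s*` of `p`;
* **Theorem 2.7** (a general `f ∈ C²([t₀, ∞))` with `f(t₀) > 0`, `f' < 0` and `f'' ≥ 0` to the left of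
  a critical point `α` with `f(α) ≤ 0`): `f` has exactly one zero `t*` in `(t₀, α)` and `{tₙ}` is
  nondecreasing and converges to `t*` ("whose proof is completely analogous to that of Theorem 1.21");
* the first part of the proof of **Theorem 1.27** (general semilocal convergence): `tₙ ≤ t*`,
  `tₙ ≤ t_{n+1}`, `v = lim tₙ` solves `f(v) = 0`, hence `v = t*`.

Held copy: `lit read book:ezquerro-fernandez2017-newtons-method-updated-approach-kantorovichs-theory`,
p. 48–49 (Theorem 1.21 with proof), p. 53–54 (Definition 1.26, Theorem 1.27 and the first part of its
proof), p. 78 (§2.1.3.1 and Theorem 2.7).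

## Rendering (what is typed)

* `f f' : ℝ → ℝ` with `HasDerivAt f (f' s) s` at every `s ∈ [t₀, t*]`; convexity is typed as
  `MonotoneOn f' (Icc t₀ t*)` (the book's `f'' ≥ 0`); "`t*` is the smallest zero of `f` in `[t₀, ∞)`"
  is typed as `f t* = 0 ∧ ∀ s ∈ [t₀, t*), 0 < f s`.  The hypotheses `f' < 0` of Theorem 2.7 and
  `N_f' ≥ 0` of the proofs are not assumed: they are CONSEQUENCES (`f'(s) ≤ −f(s)/(t* − s) < 0` by the
  mean value theorem, and `N_f` is nondecreasing on `[t₀, t*]` by comparing tangent lines), so the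
  book's `𝒞²` is not needed either.
* The sequence is an arbitrary `t : ℕ → ℝ` with `t 0 = t₀` and `t (n+1) = t n − f (t n) / f' (t n)`
  (Lean's `x / 0 = 0` makes the recursion stationary at `t*` even if `f'(t*) = 0`).
* The existence statement of §2.1.3.1 ("`f(t₀) ≥ 0 ≥ f(α)` ⟹ a smallest zero `t* ∈ [t₀, α]`, with
  `f > 0` on `[t₀, t*)`") is typed for a function continuous on `[t₀, α]`.

## Contents (everything below is proved; no definitions, no named facts)

the tangent inequality, `f' < 0` and the bounds `s < N_f(s) ≤ t*` on `[t₀, t*)`, monotonicity of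
`N_f` on `[t₀, t*]`, the invariant `t₀ ≤ tₙ ≤ t_{n+1} ≤ t*`, the linearization identity
`f(tₙ) + f'(tₙ)(t_{n+1} − tₙ) = 0`, convergence `tₙ → t*`, and the existence of the smallest zero.
-/

open Set Filter Topology

namespace Literature.Analysis.Calculus

section MajorantNewton

variable {f f' : ℝ → ℝ} {t₀ tstar : ℝ} {t : ℕ → ℝ}

/-- **Tangent inequality** for a function with nondecreasing derivative on `[t₀, t*]`: for
`t₀ ≤ s₁ ≤ s₂ ≤ t*`, `f(s₁) + f'(s₁)(s₂ − s₁) ≤ f(s₂)` (mean value theorem: `f(s₂) − f(s₁) = f'(θ)(s₂ − s₁)`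
with `f'(θ) ≥ f'(s₁)`; the book's use of `f'' ≥ 0`).
[cite: EzquerrofernandezHernandezveron2017, §1.1.2 proof of Theorem 1.21; §2.1.3.1 (p. 78: "f'' ≥ 0, so that f' is nondecreasing")] -/
theorem newtonMajorant_tangent_le (hf : ∀ s ∈ Icc t₀ tstar, HasDerivAt f (f' s) s)
    (hmono : MonotoneOn f' (Icc t₀ tstar)) {s₁ s₂ : ℝ} (h₁ : t₀ ≤ s₁) (h₁₂ : s₁ ≤ s₂)
    (h₂ : s₂ ≤ tstar) : f s₁ + f' s₁ * (s₂ - s₁) ≤ f s₂ := by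
  rcases h₁₂.eq_or_lt with h | h
  · subst h; simp
  have hsub : Icc s₁ s₂ ⊆ Icc t₀ tstar := Icc_subset_Icc h₁ h₂
  have hcont : ContinuousOn f (Icc s₁ s₂) := fun s hs =>
    (hf s (hsub hs)).continuousAt.continuousWithinAt
  have hder : ∀ s ∈ Ioo s₁ s₂, HasDerivAt f (f' s) s := fun s hs =>
    hf s (hsub (Ioo_subset_Icc_self hs))
  obtain ⟨θ, hθ, hθeq⟩ := exists_hasDerivAt_eq_slope f f' h hcont hder
  have hθ' : f' s₁ ≤ f' θ :=
    hmono ⟨h₁, h₁₂.trans h₂⟩ (hsub (Ioo_subset_Icc_self hθ)) hθ.1.le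
  have hpos : 0 < s₂ - s₁ := sub_pos.2 h
  have : f' θ * (s₂ - s₁) = f s₂ - f s₁ := by
    rw [hθeq, div_mul_cancel₀ _ hpos.ne']
  nlinarith [mul_le_mul_of_nonneg_right hθ' hpos.le]

/-- On `[t₀, t*)` the derivative is negative, quantitatively `f'(s)(t* − s) ≤ −f(s) < 0`
(Theorem 2.7's hypothesis `f' < 0` / the sign used throughout the proof of Theorem 1.21).
[cite: EzquerrofernandezHernandezveron2017, §1.1.2 proof of Theorem 1.21 ("p(t) > 0 and p'(t) < 0 in [s₀, s*)"); §2.1.3.1 Theorem 2.7] -/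
theorem newtonMajorant_deriv_neg (hf : ∀ s ∈ Icc t₀ tstar, HasDerivAt f (f' s) s)
    (hmono : MonotoneOn f' (Icc t₀ tstar)) (hzero : f tstar = 0)
    (hpos : ∀ s ∈ Ico t₀ tstar, 0 < f s) {s : ℝ} (hs : s ∈ Ico t₀ tstar) :
    f' s * (tstar - s) ≤ -f s ∧ f' s < 0 := by
  have h := newtonMajorant_tangent_le hf hmono hs.1 hs.2.le le_rfl
  rw [hzero] at h
  have hfs := hpos s hs
  refine ⟨by linarith, ?_⟩
  rcases lt_or_ge (f' s) 0 with hneg | hcon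
  · exact hneg
  · have : 0 ≤ f' s * (tstar - s) := mul_nonneg hcon (sub_nonneg.2 hs.2.le)
    linarith

/-- **The Newton map stays below the zero:** `N_f(s) = s − f(s)/f'(s) ≤ t*` for `s ∈ [t₀, t*)`
(the induction `sₙ < s* ⟹ s_{n+1} ≤ s*` of Theorem 1.21 / `t_j ≤ t* ⟹ t_{j+1} ≤ t*` of Theorem 1.27).
[cite: EzquerrofernandezHernandezveron2017, §1.1.2 proof of Theorem 1.21; §1.1.4 proof of Theorem 1.27 ("tₙ ≤ t* for all n")] -/
theorem newtonMajorant_map_le (hf : ∀ s ∈ Icc t₀ tstar, HasDerivAt f (f' s) s)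
    (hmono : MonotoneOn f' (Icc t₀ tstar)) (hzero : f tstar = 0)
    (hpos : ∀ s ∈ Ico t₀ tstar, 0 < f s) {s : ℝ} (hs : s ∈ Ico t₀ tstar) :
    s - f s / f' s ≤ tstar := by
  obtain ⟨h1, h2⟩ := newtonMajorant_deriv_neg hf hmono hzero hpos hs
  have h3 : -(f s / f' s) ≤ tstar - s := by
    rw [← neg_div, div_le_iff_of_neg h2]
    linarith
  linarith

/-- **The Newton step is positive:** `s < N_f(s)` for `s ∈ [t₀, t*)`, quantitatively
`0 < −f(s)/f'(s)` ("`sₙ − s_{n−1} = −p(s_{n−1})/p'(s_{n−1}) ≥ 0`").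
[cite: EzquerrofernandezHernandezveron2017, §1.1.2 proof of Theorem 1.21 ("{sₙ} is a nondecreasing sequence")] -/
theorem newtonMajorant_lt_map (hf : ∀ s ∈ Icc t₀ tstar, HasDerivAt f (f' s) s)
    (hmono : MonotoneOn f' (Icc t₀ tstar)) (hzero : f tstar = 0)
    (hpos : ∀ s ∈ Ico t₀ tstar, 0 < f s) {s : ℝ} (hs : s ∈ Ico t₀ tstar) :
    s < s - f s / f' s := by
  have h2 := (newtonMajorant_deriv_neg hf hmono hzero hpos hs).2
  have : f s / f' s < 0 := div_neg_of_pos_of_neg (hpos s hs) h2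
  linarith

/-- **`N_f` is nondecreasing on `[t₀, t*]`** (the book: `N_f'(t) = f(t)f''(t)/f'(t)² ≥ 0`; here from
convexity alone, by comparing the tangent lines at `s₁ ≤ s₂`: the tangent at `s₁` is nonpositive at
`N_f(s₂)`), with `N_f(t*) = t*`.
[cite: EzquerrofernandezHernandezveron2017, §1.1.2 proof of Theorem 1.21 ("N_p' > 0 in [s₀, s*)"); §1.1.4 proof of Theorem 1.27 ("as N_f' ≥ 0 in [t₀, t*), N_f is nondecreasing")] -/
theorem newtonMajorant_map_monotoneOn (hf : ∀ s ∈ Icc t₀ tstar, HasDerivAt f (f' s) s)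
    (hmono : MonotoneOn f' (Icc t₀ tstar)) (hzero : f tstar = 0)
    (hpos : ∀ s ∈ Ico t₀ tstar, 0 < f s) :
    MonotoneOn (fun s => s - f s / f' s) (Icc t₀ tstar) := by
  intro s₁ hs₁ s₂ hs₂ h₁₂
  simp only
  rcases hs₂.2.eq_or_lt with h₂ | h₂
  · -- `s₂ = t*`: `N_f(t*) = t*` and `N_f(s₁) ≤ t*`
    rw [h₂, hzero, zero_div, sub_zero]
    rcases hs₁.2.eq_or_lt with h₁ | h₁
    · rw [h₁, hzero, zero_div, sub_zero]
    · exact newtonMajorant_map_le hf hmono hzero hpos ⟨hs₁.1, h₁⟩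
  have hs₁' : s₁ ∈ Ico t₀ tstar := ⟨hs₁.1, lt_of_le_of_lt h₁₂ h₂⟩
  have hs₂' : s₂ ∈ Ico t₀ tstar := ⟨hs₂.1, h₂⟩
  have hd₁ := (newtonMajorant_deriv_neg hf hmono hzero hpos hs₁').2
  have hd₂ := (newtonMajorant_deriv_neg hf hmono hzero hpos hs₂').2
  have hf₂ := hpos s₂ hs₂'
  have htan := newtonMajorant_tangent_le hf hmono hs₁.1 h₁₂ hs₂.2
  have hmn : f' s₁ ≤ f' s₂ := hmono hs₁ hs₂ h₁₂
  have hne₁ : f' s₁ ≠ 0 := hd₁.ne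
  have hne₂ : f' s₂ ≠ 0 := hd₂.ne
  -- the tangent at `s₁` evaluated at `N_f(s₂)` is `≤ f(s₂)(f'(s₂) − f'(s₁))/f'(s₂) ≤ 0`
  have hkey : f' s₁ * ((s₂ - f s₂ / f' s₂) - (s₁ - f s₁ / f' s₁)) ≤ 0 := by
    have e1 : f' s₁ * ((s₂ - f s₂ / f' s₂) - (s₁ - f s₁ / f' s₁))
        = (f s₁ + f' s₁ * (s₂ - s₁)) - f' s₁ * (f s₂ / f' s₂) := by
      field_simp
      ring
    rw [e1]
    have e2 : f s₂ - f' s₁ * (f s₂ / f' s₂) = f s₂ * (f' s₂ - f' s₁) / f' s₂ := by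
      field_simp
    have h3 : f s₂ * (f' s₂ - f' s₁) / f' s₂ ≤ 0 :=
      div_nonpos_of_nonneg_of_nonpos (mul_nonneg hf₂.le (sub_nonneg.2 hmn)) hd₂.le
    linarith
  -- divide by `f'(s₁) < 0`
  rcases le_or_gt (s₁ - f s₁ / f' s₁) (s₂ - f s₂ / f' s₂) with hok | hcon
  · exact hok
  · have : 0 < f' s₁ * ((s₂ - f s₂ / f' s₂) - (s₁ - f s₁ / f' s₁)) :=
      mul_pos_of_neg_of_neg hd₁ (sub_neg.2 hcon)
    linarith

/-- **The invariant of Theorems 1.21 / 2.7 / 1.27:** `t₀ ≤ tₙ ≤ t*` for every `n`.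
[cite: EzquerrofernandezHernandezveron2017, §1.1.2 Theorem 1.21 (proof: "sₙ < s* for all n"); §1.1.4 proof of Theorem 1.27 ("tₙ ≤ t*"); §2.1.3.1 Theorem 2.7] -/
theorem newtonMajorant_seq_mem_Icc (hf : ∀ s ∈ Icc t₀ tstar, HasDerivAt f (f' s) s)
    (hmono : MonotoneOn f' (Icc t₀ tstar)) (hzero : f tstar = 0)
    (hpos : ∀ s ∈ Ico t₀ tstar, 0 < f s) (ht0s : t₀ ≤ tstar) (ht0 : t 0 = t₀)
    (ht : ∀ n, t (n + 1) = t n - f (t n) / f' (t n)) (n : ℕ) : t n ∈ Icc t₀ tstar := by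
  induction n with
  | zero => exact ⟨ht0.ge, ht0.le.trans ht0s⟩
  | succ n ih =>
    rw [ht n]
    rcases ih.2.eq_or_lt with h | h
    · rw [h, hzero, zero_div, sub_zero]; exact ⟨ht0s, le_rfl⟩
    · exact ⟨ih.1.trans (newtonMajorant_lt_map hf hmono hzero hpos ⟨ih.1, h⟩).le,
        newtonMajorant_map_le hf hmono hzero hpos ⟨ih.1, h⟩⟩

/-- `tₙ ≤ t_{n+1}`: the sequence (1.34) is nondecreasing (strictly increasing while `tₙ < t*`,
stationary once `tₙ = t*`). [cite: EzquerrofernandezHernandezveron2017, §1.1.2 Theorem 1.21; §1.1.4 proof of Theorem 1.27 ("sequence (1.34) is monotone"); §2.1.3.1 Theorem 2.7] -/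
theorem newtonMajorant_seq_le_succ (hf : ∀ s ∈ Icc t₀ tstar, HasDerivAt f (f' s) s)
    (hmono : MonotoneOn f' (Icc t₀ tstar)) (hzero : f tstar = 0)
    (hpos : ∀ s ∈ Ico t₀ tstar, 0 < f s) (ht0s : t₀ ≤ tstar) (ht0 : t 0 = t₀)
    (ht : ∀ n, t (n + 1) = t n - f (t n) / f' (t n)) (n : ℕ) : t n ≤ t (n + 1) := by
  have hn := newtonMajorant_seq_mem_Icc hf hmono hzero hpos ht0s ht0 ht n
  rw [ht n]
  rcases hn.2.eq_or_lt with h | h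
  · rw [h, hzero, zero_div, sub_zero]
  · exact (newtonMajorant_lt_map hf hmono hzero hpos ⟨hn.1, h⟩).le

/-- The sequence (1.34) is monotone (nondecreasing) and bounded above by `t*`.
[cite: EzquerrofernandezHernandezveron2017, §1.1.2 Theorem 1.21; §2.1.3.1 Theorem 2.7 ("{tₙ} is nondecreasing")] -/
theorem newtonMajorant_seq_monotone (hf : ∀ s ∈ Icc t₀ tstar, HasDerivAt f (f' s) s)
    (hmono : MonotoneOn f' (Icc t₀ tstar)) (hzero : f tstar = 0)
    (hpos : ∀ s ∈ Ico t₀ tstar, 0 < f s) (ht0s : t₀ ≤ tstar) (ht0 : t 0 = t₀)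
    (ht : ∀ n, t (n + 1) = t n - f (t n) / f' (t n)) :
    Monotone t ∧ ∀ n, t n ≤ tstar :=
  ⟨monotone_nat_of_le_succ (newtonMajorant_seq_le_succ hf hmono hzero hpos ht0s ht0 ht),
    fun n => (newtonMajorant_seq_mem_Icc hf hmono hzero hpos ht0s ht0 ht n).2⟩

/-- **The linearization identity of the Newton step:** `f(tₙ) + f'(tₙ)(t_{n+1} − tₙ) = 0` for every
`n` (for `tₙ < t*` because `f'(tₙ) ≠ 0`; at `tₙ = t*` both terms vanish).  This is the identity that
turns the second-order remainder bound into `‖F(x_{n+1})‖ ≤ f(t_{n+1})` in the proof of Theorem 1.27.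
[cite: EzquerrofernandezHernandezveron2017, §1.1.4 (1.34) and proof of Theorem 1.27; §1.1.2 proof of Theorem 1.23 (p. 51)] -/
theorem newtonMajorant_seq_linearization (hf : ∀ s ∈ Icc t₀ tstar, HasDerivAt f (f' s) s)
    (hmono : MonotoneOn f' (Icc t₀ tstar)) (hzero : f tstar = 0)
    (hpos : ∀ s ∈ Ico t₀ tstar, 0 < f s) (ht0s : t₀ ≤ tstar) (ht0 : t 0 = t₀)
    (ht : ∀ n, t (n + 1) = t n - f (t n) / f' (t n)) (n : ℕ) :
    f (t n) + f' (t n) * (t (n + 1) - t n) = 0 := by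
  have hn := newtonMajorant_seq_mem_Icc hf hmono hzero hpos ht0s ht0 ht n
  rw [ht n]
  rcases hn.2.eq_or_lt with h | h
  · rw [h, hzero, zero_div]; ring
  · have hd := (newtonMajorant_deriv_neg hf hmono hzero hpos ⟨hn.1, h⟩).2.ne
    field_simp
    ring

/-- **Convergence (Theorems 1.21, 2.7; first part of the proof of Theorem 1.27):** the sequence (1.34)
converges to `t*` (its limit `v ∈ [t₀, t*]` exists by monotonicity; `f(tₙ) = −f'(tₙ)(t_{n+1} − tₙ)`
with `|f'(tₙ)| ≤ |f'(t₀)|` forces `f(v) = 0`, and `t*` is the only zero of `f` in `[t₀, t*]`).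
[cite: EzquerrofernandezHernandezveron2017, §1.1.2 Theorem 1.21; §1.1.4 Theorem 1.27 (proof, "v = lim tₙ … v = t*"); §2.1.3.1 Theorem 2.7] -/
theorem newtonMajorant_seq_tendsto (hf : ∀ s ∈ Icc t₀ tstar, HasDerivAt f (f' s) s)
    (hmono : MonotoneOn f' (Icc t₀ tstar)) (hzero : f tstar = 0)
    (hpos : ∀ s ∈ Ico t₀ tstar, 0 < f s) (ht0s : t₀ ≤ tstar) (ht0 : t 0 = t₀)
    (ht : ∀ n, t (n + 1) = t n - f (t n) / f' (t n)) : Tendsto t atTop (𝓝 tstar) := by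
  obtain ⟨hmon, hle⟩ := newtonMajorant_seq_monotone hf hmono hzero hpos ht0s ht0 ht
  have hmem := newtonMajorant_seq_mem_Icc hf hmono hzero hpos ht0s ht0 ht
  -- the limit `v`
  have hbdd : BddAbove (range t) := ⟨tstar, by rintro _ ⟨n, rfl⟩; exact hle n⟩
  have hT : Tendsto t atTop (𝓝 (⨆ n, t n)) := tendsto_atTop_ciSup hmon hbdd
  set v := ⨆ n, t n with hv
  have hvle : v ≤ tstar := ciSup_le hle
  have hv0 : t₀ ≤ v := (hmem 0).1.trans (le_ciSup hbdd 0)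
  -- `f(v) = 0`
  have hfv : f v = 0 := by
    have hcont : ContinuousAt f v := (hf v ⟨hv0, hvle⟩).continuousAt
    have h1 : Tendsto (fun n => f (t n)) atTop (𝓝 (f v)) := hcont.tendsto.comp hT
    -- `|f(tₙ)| ≤ (−f'(t₀)) (t_{n+1} − tₙ) → 0`
    have h2 : Tendsto (fun n => f (t n)) atTop (𝓝 0) := by
      have hstep : Tendsto (fun n => t (n + 1) - t n) atTop (𝓝 0) := by
        have := (hT.comp (tendsto_add_atTop_nat 1)).sub hT
        simpa using this
      have hbound : ∀ n, |f (t n)| ≤ (-f' t₀) * (t (n + 1) - t n) := by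
        intro n
        have hlin := newtonMajorant_seq_linearization hf hmono hzero hpos ht0s ht0 ht n
        have hΔ : 0 ≤ t (n + 1) - t n := sub_nonneg.2 (hmon (Nat.le_succ n))
        rcases (hmem n).2.eq_or_lt with h | h
        · -- `tₙ = t*`: `f(tₙ) = 0`
          have : f (t n) = 0 := by rw [h, hzero]
          rw [this, abs_zero]
          rcases ht0s.eq_or_lt with h0 | h0
          · -- degenerate `t₀ = t*`: the step is `0`
            have e : t (n + 1) - t n = 0 := by
              have h' := (hmem (n + 1)); rw [← h0] at h'; rw [← h0] at h
              have : t (n + 1) = t₀ := le_antisymm h'.2 h'.1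
              rw [this, h]; ring
            rw [e, mul_zero]
          · exact mul_nonneg (by linarith [(newtonMajorant_deriv_neg hf hmono hzero hpos
              ⟨le_rfl, h0⟩).2]) hΔ
        · have hdn := (newtonMajorant_deriv_neg hf hmono hzero hpos ⟨(hmem n).1, h⟩).2
          have hd0 : f' t₀ ≤ f' (t n) :=
            hmono ⟨le_rfl, ht0s⟩ (hmem n) (hmem n).1
          have e : f (t n) = (-f' (t n)) * (t (n + 1) - t n) := by linarith
          rw [e, abs_of_nonneg (mul_nonneg (by linarith) hΔ)]
          exact mul_le_mul_of_nonneg_right (by linarith) hΔ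
      have h3 : Tendsto (fun n => (-f' t₀) * (t (n + 1) - t n)) atTop (𝓝 0) := by
        simpa using hstep.const_mul (-f' t₀)
      exact squeeze_zero_norm (fun n => by simpa [Real.norm_eq_abs] using hbound n) h3
    exact tendsto_nhds_unique h1 h2
  -- `v = t*`
  have hveq : v = tstar := by
    by_contra hne
    have hlt : v < tstar := lt_of_le_of_ne hvle hne
    exact (hpos v ⟨hv0, hlt⟩).ne' hfv
  rwa [hveq] at hT

end MajorantNewton

section SmallestZero

/-- **Existence of the smallest zero (§2.1.3.1):** if `f` is continuous on `[t₀, α]` with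
`f(t₀) ≥ 0 ≥ f(α)`, then `f` has a smallest zero `t*` in `[t₀, α]`, and `f > 0` on `[t₀, t*)`
("if `f(α) < 0`, as `f(t₀) > 0`, then `f` has at least one zero in `(t₀, α)` by continuity").
[cite: EzquerrofernandezHernandezveron2017, §2.1.3.1 (p. 78, existence of the zero t* of the majorant function); Theorem 2.7] -/
theorem newtonMajorant_exists_smallest_zero {f : ℝ → ℝ} {t₀ α : ℝ} (hα : t₀ ≤ α)
    (hcont : ContinuousOn f (Icc t₀ α)) (h0 : 0 ≤ f t₀) (hfα : f α ≤ 0) :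
    ∃ tstar ∈ Icc t₀ α, f tstar = 0 ∧ ∀ s ∈ Ico t₀ tstar, 0 < f s := by
  set Z : Set ℝ := Icc t₀ α ∩ f ⁻¹' (Iic 0) with hZ
  have hZc : IsClosed Z := hcont.preimage_isClosed_of_isClosed isClosed_Icc isClosed_Iic
  have hZne : Z.Nonempty := ⟨α, ⟨hα, le_rfl⟩, hfα⟩
  have hZb : BddBelow Z := ⟨t₀, fun s hs => hs.1.1⟩
  set tstar := sInf Z with htstar
  have hmemZ : tstar ∈ Z := hZc.csInf_mem hZne hZb
  have hle : ∀ s ∈ Z, tstar ≤ s := fun s hs => csInf_le hZb hs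
  refine ⟨tstar, hmemZ.1, ?_, ?_⟩
  · -- `f(t*) = 0`: `f(t*) ≤ 0`, and a zero in `[t₀, t*]` given by the intermediate value theorem
    -- is `≥ t*`
    have hfle : f tstar ≤ 0 := hmemZ.2
    have hsub : Icc t₀ tstar ⊆ Icc t₀ α := Icc_subset_Icc le_rfl hmemZ.1.2
    have hivt := intermediate_value_Icc' hmemZ.1.1 (hcont.mono hsub)
    obtain ⟨c, hc, hfc⟩ := hivt ⟨hfle, h0⟩
    have hcZ : c ∈ Z := ⟨hsub hc, le_of_eq hfc⟩
    have : c = tstar := le_antisymm hc.2 (hle c hcZ)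
    rw [← this]; exact hfc
  · intro s hs
    rcases lt_or_ge 0 (f s) with hok | hcon
    · exact hok
    · have hsZ : s ∈ Z := ⟨⟨hs.1, hs.2.le.trans hmemZ.1.2⟩, hcon⟩
      exact absurd (hle s hsZ) (not_le.2 hs.2)

end SmallestZero

end Literature.Analysis.Calculus
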